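import Mathlib
import Summits.MatrixMultiplication.MatrixMultiplication.Theorems.LevelGradedCohnUmansGradedDesignFamilyStubSubfieldCellSixteenSepA
import Summits.MatrixMultiplication.MatrixMultiplication.Theorems.LevelGradedCohnUmansGradedDesignFamilyStubSubfieldCellSixteenSepB
import Summits.MatrixMultiplication.MatrixMultiplication.Theorems.LevelGradedCohnUmansGradedDesignFamilyStubSubfieldCellSixteenSepC

/-!
# A TRUE finite instance of the subfield-cell clause of `stub_subfieldCell` at `|K| = 16`

Route `LevelGradedCohnUmans`, crux `GradedDesignFamily` (stmt-MatrixMultiplication-7610), stub S3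
`stub_subfieldCell` (registered line `quadratic_extension_level_one_cell`; the subfield cell
`GL₂(𝔽_{q²}) ⊃ SL₂(𝔽_q)`, here `q = 4`).  Companion of the `|K| = 9` witness
`LevelGradedCohnUmansGradedDesignFamilyStubSubfieldCellNineWitness.lean`.

HONEST FRAMING.  The stub is ASYMPTOTIC and this file decides nothing about it.  It proves that the
stub's INNER CLAUSE (injective `φ : SL₂(k) →* GL₂(K)`, `|K| = |k|²`, finite `Y, Z ⊆ GL₂(K)`, a frame
separator for every `z₀ ∈ Z`) has a witness with `|K| = 16`, `|Y| = |Z| = 5` — the largest level-one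
separated design known in the cell `q = 4` (volume `|SL₂(𝔽₄)|·|Y|·|Z| = 60·25 = 1500`, against the
landed exponent-3 ceiling `60·|Y|·|Z| ≤ 40560 < 72879` of
`GradedDesignFamily/Negative/SubfieldCellSixteenCubes.lean`).  VALUE = certificate — a compiler-checked
TRUE instance next to the landed NEGATIVE verdicts — NOT summit progress.

LEAN.  `subfieldCell_sixteen_pack` is the bookkeeping: from indexed units `yOf`, `zOf`, an explicit
list `slOf` exhausting `SL₂(𝔽₄)`, a finset `S` of vectors and, for every target `j`, an integer table
`g` on `S` with denominator `N > 0` satisfying the separation identities in integer form, the clause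
follows with `cf u v = [u ∈ S] · g u v / N`.  `subfieldCell_sixteen_witness` instantiates it: the field
instances are Mathlib's computable `QuadraticAlgebra` ones (`𝔽₄ = QuadraticAlgebra (ZMod 2) 1 1`,
`𝔽₁₆ = QuadraticAlgebra 𝔽₄ x 1`, `Fintype` via `equivProd`, written as closed terms so that the
decision procedures compile), the per-target identities are the theorems
`subfieldCell_sixteen_sep0 … sep4` of the three DATA files `…SixteenSepA/B/C.lean` (one `native_decide`
each), exhaustiveness of the `SL₂(𝔽₄)` list is `native_decide`, injectivity of `yOf`, `zOf` and the
inverse checks are kernel `decide`.  Theorems only: no `def`, no notation.  Data provenance: gen-1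
design `cert/q4_full_5x5_cyclicC5.json`, exact certificate `cert3/q4a_exact.json` (Dixon lifting,
verified in exact integer arithmetic by `cert3/verify_exact.py`), generator `calc3/genlean4.py`; cell
dossier `SUBFIELD.md` §8 (HOME `run/shared/lean/b2b/levelgraded-cu/`).
-/

namespace Summit.MatrixMultiplication.MatrixMultiplication.Theorems.GradedDesignFamily

open Matrix

/-- **Packaging lemma** for finite instances of the subfield-cell clause at `|K| = 16`
(`k = 𝔽₄ = QuadraticAlgebra (ZMod 2) 1 1`, `K = 𝔽₁₆ = QuadraticAlgebra 𝔽₄ x 1`): indexed units `yOf`, `zOf`,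
a list `slOf` exhausting `SL₂(𝔽₄)`, a finset `S` of vectors and per-target integer tables on `S` with
positive denominators satisfying the separation identities in integer form (product matrix bound once by
`let`) give the clause with `Y = range yOf`, `Z = range zOf`, `cf u v = [u ∈ S] · g u v / N`.
(Pure bookkeeping; certificate use only, not summit progress.) -/
theorem subfieldCell_sixteen_pack
    [hF4 : Fact (∀ r : ZMod 2, r ^ 2 ≠ 1 + 1 * r)]
    [hF16 : Fact (∀ r : QuadraticAlgebra (ZMod 2) 1 1, r ^ 2 ≠ ⟨0, 1⟩ + 1 * r)]
    [hK4 : Fintype (QuadraticAlgebra (ZMod 2) 1 1)] [hK16 : Fintype (QuadraticAlgebra (QuadraticAlgebra (ZMod 2) 1 1) ⟨0, 1⟩ 1)]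
    (h4 : Fintype.card (QuadraticAlgebra (ZMod 2) 1 1) = 4) (h16 : Fintype.card (QuadraticAlgebra (QuadraticAlgebra (ZMod 2) 1 1) ⟨0, 1⟩ 1) = 16) {ny nz m : ℕ}
    (yOf : Fin ny → GL (Fin 2) (QuadraticAlgebra (QuadraticAlgebra (ZMod 2) 1 1) ⟨0, 1⟩ 1)) (zOf : Fin nz → GL (Fin 2) (QuadraticAlgebra (QuadraticAlgebra (ZMod 2) 1 1) ⟨0, 1⟩ 1))
    (slOf : Fin m → Matrix.SpecialLinearGroup (Fin 2) (QuadraticAlgebra (ZMod 2) 1 1))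
    (S : Finset (Fin 2 → QuadraticAlgebra (QuadraticAlgebra (ZMod 2) 1 1) ⟨0, 1⟩ 1))
    (hy : Function.Injective yOf) (hz : Function.Injective zOf)
    (hsl : ∀ a ∈ (Finset.univ : Finset (Matrix.SpecialLinearGroup (Fin 2) (QuadraticAlgebra (ZMod 2) 1 1))),
      ∃ n : Fin m, slOf n = a)
    (hsep : ∀ j : Fin nz, ∃ (g : (Fin 2 → QuadraticAlgebra (QuadraticAlgebra (ZMod 2) 1 1) ⟨0, 1⟩ 1) → (Fin 2 → QuadraticAlgebra (QuadraticAlgebra (ZMod 2) 1 1) ⟨0, 1⟩ 1) → ℤ) (N : ℕ), 0 < N ∧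
      ∀ n : Fin m, ∀ i i' : Fin ny, ∀ l : Fin nz,
        (let X : Matrix (Fin 2) (Fin 2) (QuadraticAlgebra (QuadraticAlgebra (ZMod 2) 1 1) ⟨0, 1⟩ 1) :=
            ((Matrix.SpecialLinearGroup.mapGL (QuadraticAlgebra (QuadraticAlgebra (ZMod 2) 1 1) ⟨0, 1⟩ 1) (slOf n) *
                  yOf i * (yOf i')⁻¹ * zOf l :
                GL (Fin 2) (QuadraticAlgebra (QuadraticAlgebra (ZMod 2) 1 1) ⟨0, 1⟩ 1)) : Matrix (Fin 2) (Fin 2) (QuadraticAlgebra (QuadraticAlgebra (ZMod 2) 1 1) ⟨0, 1⟩ 1))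
          let x₀₀ : QuadraticAlgebra (QuadraticAlgebra (ZMod 2) 1 1) ⟨0, 1⟩ 1 := X 0 0
          let x₀₁ : QuadraticAlgebra (QuadraticAlgebra (ZMod 2) 1 1) ⟨0, 1⟩ 1 := X 0 1
          let x₁₀ : QuadraticAlgebra (QuadraticAlgebra (ZMod 2) 1 1) ⟨0, 1⟩ 1 := X 1 0
          let x₁₁ : QuadraticAlgebra (QuadraticAlgebra (ZMod 2) 1 1) ⟨0, 1⟩ 1 := X 1 1
          ∑ u ∈ S, g u (!![x₀₀, x₀₁; x₁₀, x₁₁].mulVec u)) =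
          if slOf n = 1 ∧ yOf i = yOf i' ∧ zOf l = zOf j then (N : ℤ) else 0) :
    ∃ (k K : Type) (_ : Field k) (_ : Fintype k) (_ : DecidableEq k)
      (_ : Field K) (_ : Fintype K) (_ : DecidableEq K)
      (φ : Matrix.SpecialLinearGroup (Fin 2) k →* Matrix.GeneralLinearGroup (Fin 2) K),
      Function.Injective φ ∧ Fintype.card K = Fintype.card k ^ 2 ∧ Fintype.card K = 16 ∧
      ∃ Y Z : Finset (Matrix.GeneralLinearGroup (Fin 2) K),
        Y.card = ny ∧ Z.card = nz ∧
        ∀ z₀ ∈ Z, ∃ cf : (Fin 2 → K) → (Fin 2 → K) → ℂ,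
          ∀ a : Matrix.SpecialLinearGroup (Fin 2) k, ∀ y ∈ Y, ∀ y' ∈ Y, ∀ z ∈ Z,
            (∑ u : Fin 2 → K, cf u (((φ a * y * y'⁻¹ * z : Matrix.GeneralLinearGroup (Fin 2) K) :
                Matrix (Fin 2) (Fin 2) K).mulVec u)) =
              if a = 1 ∧ y = y' ∧ z = z₀ then 1 else 0 := by
  refine ⟨QuadraticAlgebra (ZMod 2) 1 1, QuadraticAlgebra (QuadraticAlgebra (ZMod 2) 1 1) ⟨0, 1⟩ 1, inferInstance, hK4, inferInstance,
    inferInstance, hK16, inferInstance, Matrix.SpecialLinearGroup.mapGL (QuadraticAlgebra (QuadraticAlgebra (ZMod 2) 1 1) ⟨0, 1⟩ 1),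
    ?_, ?_, h16, Finset.univ.image yOf, Finset.univ.image zOf, ?_, ?_, ?_⟩
  · intro a a' h
    have h' := congrArg
      (fun w : GL (Fin 2) (QuadraticAlgebra (QuadraticAlgebra (ZMod 2) 1 1) ⟨0, 1⟩ 1) => (w : Matrix (Fin 2) (Fin 2) (QuadraticAlgebra (QuadraticAlgebra (ZMod 2) 1 1) ⟨0, 1⟩ 1))) h
    simp only [Matrix.SpecialLinearGroup.mapGL_coe_matrix] at h'
    exact Subtype.ext (Matrix.map_injective QuadraticAlgebra.algebraMap_injective h')
  · rw [h16, h4]; norm_num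
  · rw [Finset.card_image_of_injective _ hy]; simp
  · rw [Finset.card_image_of_injective _ hz]; simp
  intro z₀ hz₀
  obtain ⟨j, -, rfl⟩ := Finset.mem_image.mp hz₀
  obtain ⟨g, N, hN, key⟩ := hsep j
  refine ⟨fun u v => if u ∈ S then (g u v : ℂ) / (N : ℂ) else 0, ?_⟩
  intro a y hy₁ y' hy₂ z hz₁
  obtain ⟨i, -, rfl⟩ := Finset.mem_image.mp hy₁
  obtain ⟨i', -, rfl⟩ := Finset.mem_image.mp hy₂
  obtain ⟨l, -, rfl⟩ := Finset.mem_image.mp hz₁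
  obtain ⟨n, rfl⟩ := hsl a (Finset.mem_univ _)
  have hNj : (N : ℂ) ≠ 0 := by exact_mod_cast hN.ne'
  have key' := key n i i' l
  dsimp only at key'
  rw [← Matrix.eta_fin_two] at key'
  simp only [Finset.sum_ite_mem, Finset.univ_inter]
  rw [← Finset.sum_div, div_eq_iff hNj]
  have hk : (∑ u ∈ S, (g u
      (((Matrix.SpecialLinearGroup.mapGL (QuadraticAlgebra (QuadraticAlgebra (ZMod 2) 1 1) ⟨0, 1⟩ 1) (slOf n) * yOf i * (yOf i')⁻¹ * zOf l :
        GL (Fin 2) (QuadraticAlgebra (QuadraticAlgebra (ZMod 2) 1 1) ⟨0, 1⟩ 1)) : Matrix (Fin 2) (Fin 2) (QuadraticAlgebra (QuadraticAlgebra (ZMod 2) 1 1) ⟨0, 1⟩ 1)).mulVec u) : ℂ)) =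
      ((if slOf n = 1 ∧ yOf i = yOf i' ∧ zOf l = zOf j then (N : ℤ) else 0 : ℤ) : ℂ) := by
    exact_mod_cast key'
  rw [hk]
  split_ifs <;> simp

set_option maxHeartbeats 20000000 in
/-- **TRUE instance of the subfield-cell clause at `|K| = 16` with `|Y| = 5`, `|Z| = 5`.**  The
binder structure is that of `stub_subfieldCell` with the asymptotic prefix replaced by the concrete
cardinalities; all data is explicit (this file and the DATA files it imports).  (Certificate; not
summit progress.) -/
theorem subfieldCell_sixteen_witness :
    ∃ (k K : Type) (_ : Field k) (_ : Fintype k) (_ : DecidableEq k)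
      (_ : Field K) (_ : Fintype K) (_ : DecidableEq K)
      (φ : Matrix.SpecialLinearGroup (Fin 2) k →* Matrix.GeneralLinearGroup (Fin 2) K),
      Function.Injective φ ∧ Fintype.card K = Fintype.card k ^ 2 ∧ Fintype.card K = 16 ∧
      ∃ Y Z : Finset (Matrix.GeneralLinearGroup (Fin 2) K),
        Y.card = 5 ∧ Z.card = 5 ∧
        ∀ z₀ ∈ Z, ∃ cf : (Fin 2 → K) → (Fin 2 → K) → ℂ,
          ∀ a : Matrix.SpecialLinearGroup (Fin 2) k, ∀ y ∈ Y, ∀ y' ∈ Y, ∀ z ∈ Z,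
            (∑ u : Fin 2 → K, cf u (((φ a * y * y'⁻¹ * z : Matrix.GeneralLinearGroup (Fin 2) K) :
                Matrix (Fin 2) (Fin 2) K).mulVec u)) =
              if a = 1 ∧ y = y' ∧ z = z₀ then 1 else 0 :=
  subfieldCell_sixteen_pack (hF4 := ⟨by decide⟩)
    (hF16 := ⟨fun r => by obtain ⟨a, b⟩ := r; revert a b; decide⟩)
    (hK4 := (Fintype.ofEquiv _ (QuadraticAlgebra.equivProd (1 : ZMod 2) 1).symm : Fintype (QuadraticAlgebra (ZMod 2) 1 1)))
    (hK16 := (@Fintype.ofEquiv (QuadraticAlgebra (QuadraticAlgebra (ZMod 2) 1 1) ⟨0, 1⟩ 1) ((QuadraticAlgebra (ZMod 2) 1 1) × (QuadraticAlgebra (ZMod 2) 1 1))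
        (@instFintypeProd (QuadraticAlgebra (ZMod 2) 1 1) (QuadraticAlgebra (ZMod 2) 1 1) (Fintype.ofEquiv _ (QuadraticAlgebra.equivProd (1 : ZMod 2) 1).symm : Fintype (QuadraticAlgebra (ZMod 2) 1 1))
          (Fintype.ofEquiv _ (QuadraticAlgebra.equivProd (1 : ZMod 2) 1).symm : Fintype (QuadraticAlgebra (ZMod 2) 1 1)))
        (QuadraticAlgebra.equivProd (⟨0, 1⟩ : QuadraticAlgebra (ZMod 2) 1 1) 1).symm))
    (h4 := rfl) (h16 := rfl)
    -- `yOf` : the `Y` side (a cyclic group of order 5), each unit with its inverse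
    (![⟨!![⟨⟨1, 0⟩, ⟨0, 0⟩⟩, ⟨⟨0, 0⟩, ⟨0, 0⟩⟩; ⟨⟨0, 0⟩, ⟨0, 0⟩⟩, ⟨⟨1, 0⟩, ⟨0, 0⟩⟩], !![⟨⟨1, 0⟩, ⟨0, 0⟩⟩, ⟨⟨0, 0⟩, ⟨0, 0⟩⟩; ⟨⟨0, 0⟩, ⟨0, 0⟩⟩, ⟨⟨1, 0⟩, ⟨0, 0⟩⟩], by decide, by decide⟩,
      ⟨!![⟨⟨1, 1⟩, ⟨0, 0⟩⟩, ⟨⟨0, 0⟩, ⟨0, 1⟩⟩; ⟨⟨0, 0⟩, ⟨0, 1⟩⟩, ⟨⟨0, 1⟩, ⟨0, 1⟩⟩], !![⟨⟨0, 1⟩, ⟨1, 1⟩⟩, ⟨⟨1, 0⟩, ⟨0, 0⟩⟩; ⟨⟨1, 0⟩, ⟨0, 0⟩⟩, ⟨⟨1, 0⟩, ⟨1, 0⟩⟩], by decide, by decide⟩,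
      ⟨!![⟨⟨0, 1⟩, ⟨1, 1⟩⟩, ⟨⟨1, 0⟩, ⟨0, 0⟩⟩; ⟨⟨1, 0⟩, ⟨0, 0⟩⟩, ⟨⟨1, 0⟩, ⟨1, 0⟩⟩], !![⟨⟨1, 1⟩, ⟨0, 0⟩⟩, ⟨⟨0, 0⟩, ⟨0, 1⟩⟩; ⟨⟨0, 0⟩, ⟨0, 1⟩⟩, ⟨⟨0, 1⟩, ⟨0, 1⟩⟩], by decide, by decide⟩,
      ⟨!![⟨⟨1, 1⟩, ⟨1, 1⟩⟩, ⟨⟨1, 0⟩, ⟨1, 0⟩⟩; ⟨⟨1, 0⟩, ⟨1, 0⟩⟩, ⟨⟨1, 1⟩, ⟨0, 0⟩⟩], !![⟨⟨1, 0⟩, ⟨0, 1⟩⟩, ⟨⟨1, 1⟩, ⟨0, 1⟩⟩; ⟨⟨1, 1⟩, ⟨0, 1⟩⟩, ⟨⟨0, 1⟩, ⟨1, 0⟩⟩], by decide, by decide⟩,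
      ⟨!![⟨⟨1, 0⟩, ⟨0, 1⟩⟩, ⟨⟨1, 1⟩, ⟨0, 1⟩⟩; ⟨⟨1, 1⟩, ⟨0, 1⟩⟩, ⟨⟨0, 1⟩, ⟨1, 0⟩⟩], !![⟨⟨1, 1⟩, ⟨1, 1⟩⟩, ⟨⟨1, 0⟩, ⟨1, 0⟩⟩; ⟨⟨1, 0⟩, ⟨1, 0⟩⟩, ⟨⟨1, 1⟩, ⟨0, 0⟩⟩], by decide, by decide⟩] :
        Fin 5 → GL (Fin 2) (QuadraticAlgebra (QuadraticAlgebra (ZMod 2) 1 1) ⟨0, 1⟩ 1))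
    -- `zOf` : the targets `Z`
    (![⟨!![⟨⟨1, 0⟩, ⟨0, 0⟩⟩, ⟨⟨0, 0⟩, ⟨0, 0⟩⟩; ⟨⟨0, 0⟩, ⟨0, 0⟩⟩, ⟨⟨1, 0⟩, ⟨0, 0⟩⟩], !![⟨⟨1, 0⟩, ⟨0, 0⟩⟩, ⟨⟨0, 0⟩, ⟨0, 0⟩⟩; ⟨⟨0, 0⟩, ⟨0, 0⟩⟩, ⟨⟨1, 0⟩, ⟨0, 0⟩⟩], by decide, by decide⟩,
      ⟨!![⟨⟨0, 0⟩, ⟨0, 0⟩⟩, ⟨⟨1, 1⟩, ⟨1, 1⟩⟩; ⟨⟨0, 0⟩, ⟨1, 0⟩⟩, ⟨⟨1, 0⟩, ⟨0, 0⟩⟩], !![⟨⟨1, 0⟩, ⟨0, 0⟩⟩, ⟨⟨1, 1⟩, ⟨1, 1⟩⟩; ⟨⟨0, 0⟩, ⟨1, 0⟩⟩, ⟨⟨0, 0⟩, ⟨0, 0⟩⟩], by decide, by decide⟩,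
      ⟨!![⟨⟨0, 0⟩, ⟨0, 0⟩⟩, ⟨⟨1, 1⟩, ⟨1, 0⟩⟩; ⟨⟨0, 1⟩, ⟨1, 0⟩⟩, ⟨⟨0, 1⟩, ⟨0, 0⟩⟩], !![⟨⟨1, 1⟩, ⟨0, 0⟩⟩, ⟨⟨1, 0⟩, ⟨0, 1⟩⟩; ⟨⟨1, 1⟩, ⟨0, 1⟩⟩, ⟨⟨0, 0⟩, ⟨0, 0⟩⟩], by decide, by decide⟩,
      ⟨!![⟨⟨1, 1⟩, ⟨1, 0⟩⟩, ⟨⟨0, 1⟩, ⟨0, 1⟩⟩; ⟨⟨1, 0⟩, ⟨1, 0⟩⟩, ⟨⟨0, 1⟩, ⟨1, 0⟩⟩], !![⟨⟨1, 1⟩, ⟨1, 0⟩⟩, ⟨⟨1, 0⟩, ⟨0, 0⟩⟩; ⟨⟨1, 1⟩, ⟨0, 0⟩⟩, ⟨⟨1, 1⟩, ⟨1, 1⟩⟩], by decide, by decide⟩,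
      ⟨!![⟨⟨1, 1⟩, ⟨0, 1⟩⟩, ⟨⟨0, 0⟩, ⟨0, 1⟩⟩; ⟨⟨1, 1⟩, ⟨0, 0⟩⟩, ⟨⟨1, 0⟩, ⟨1, 0⟩⟩], !![⟨⟨1, 0⟩, ⟨0, 1⟩⟩, ⟨⟨1, 0⟩, ⟨0, 0⟩⟩; ⟨⟨1, 0⟩, ⟨1, 0⟩⟩, ⟨⟨0, 0⟩, ⟨1, 0⟩⟩], by decide, by decide⟩] :
        Fin 5 → GL (Fin 2) (QuadraticAlgebra (QuadraticAlgebra (ZMod 2) 1 1) ⟨0, 1⟩ 1))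
    -- `slOf` : all of `SL₂(𝔽₄)` (identity first)
    (![⟨!![⟨1, 0⟩, ⟨0, 0⟩; ⟨0, 0⟩, ⟨1, 0⟩], by rw [Matrix.det_fin_two_of]; decide⟩,
      ⟨!![⟨0, 0⟩, ⟨1, 0⟩; ⟨1, 0⟩, ⟨0, 0⟩], by rw [Matrix.det_fin_two_of]; decide⟩,
      ⟨!![⟨0, 0⟩, ⟨1, 0⟩; ⟨1, 0⟩, ⟨1, 0⟩], by rw [Matrix.det_fin_two_of]; decide⟩,
      ⟨!![⟨0, 0⟩, ⟨1, 0⟩; ⟨1, 0⟩, ⟨0, 1⟩], by rw [Matrix.det_fin_two_of]; decide⟩,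
      ⟨!![⟨0, 0⟩, ⟨1, 0⟩; ⟨1, 0⟩, ⟨1, 1⟩], by rw [Matrix.det_fin_two_of]; decide⟩,
      ⟨!![⟨0, 0⟩, ⟨0, 1⟩; ⟨1, 1⟩, ⟨0, 0⟩], by rw [Matrix.det_fin_two_of]; decide⟩,
      ⟨!![⟨0, 0⟩, ⟨0, 1⟩; ⟨1, 1⟩, ⟨1, 0⟩], by rw [Matrix.det_fin_two_of]; decide⟩,
      ⟨!![⟨0, 0⟩, ⟨0, 1⟩; ⟨1, 1⟩, ⟨0, 1⟩], by rw [Matrix.det_fin_two_of]; decide⟩,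
      ⟨!![⟨0, 0⟩, ⟨0, 1⟩; ⟨1, 1⟩, ⟨1, 1⟩], by rw [Matrix.det_fin_two_of]; decide⟩,
      ⟨!![⟨0, 0⟩, ⟨1, 1⟩; ⟨0, 1⟩, ⟨0, 0⟩], by rw [Matrix.det_fin_two_of]; decide⟩,
      ⟨!![⟨0, 0⟩, ⟨1, 1⟩; ⟨0, 1⟩, ⟨1, 0⟩], by rw [Matrix.det_fin_two_of]; decide⟩,
      ⟨!![⟨0, 0⟩, ⟨1, 1⟩; ⟨0, 1⟩, ⟨0, 1⟩], by rw [Matrix.det_fin_two_of]; decide⟩,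
      ⟨!![⟨0, 0⟩, ⟨1, 1⟩; ⟨0, 1⟩, ⟨1, 1⟩], by rw [Matrix.det_fin_two_of]; decide⟩,
      ⟨!![⟨1, 0⟩, ⟨0, 0⟩; ⟨1, 0⟩, ⟨1, 0⟩], by rw [Matrix.det_fin_two_of]; decide⟩,
      ⟨!![⟨1, 0⟩, ⟨0, 0⟩; ⟨0, 1⟩, ⟨1, 0⟩], by rw [Matrix.det_fin_two_of]; decide⟩,
      ⟨!![⟨1, 0⟩, ⟨0, 0⟩; ⟨1, 1⟩, ⟨1, 0⟩], by rw [Matrix.det_fin_two_of]; decide⟩,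
      ⟨!![⟨1, 0⟩, ⟨1, 0⟩; ⟨0, 0⟩, ⟨1, 0⟩], by rw [Matrix.det_fin_two_of]; decide⟩,
      ⟨!![⟨1, 0⟩, ⟨1, 0⟩; ⟨1, 0⟩, ⟨0, 0⟩], by rw [Matrix.det_fin_two_of]; decide⟩,
      ⟨!![⟨1, 0⟩, ⟨1, 0⟩; ⟨0, 1⟩, ⟨1, 1⟩], by rw [Matrix.det_fin_two_of]; decide⟩,
      ⟨!![⟨1, 0⟩, ⟨1, 0⟩; ⟨1, 1⟩, ⟨0, 1⟩], by rw [Matrix.det_fin_two_of]; decide⟩,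
      ⟨!![⟨1, 0⟩, ⟨0, 1⟩; ⟨0, 0⟩, ⟨1, 0⟩], by rw [Matrix.det_fin_two_of]; decide⟩,
      ⟨!![⟨1, 0⟩, ⟨0, 1⟩; ⟨1, 0⟩, ⟨1, 1⟩], by rw [Matrix.det_fin_two_of]; decide⟩,
      ⟨!![⟨1, 0⟩, ⟨0, 1⟩; ⟨0, 1⟩, ⟨0, 1⟩], by rw [Matrix.det_fin_two_of]; decide⟩,
      ⟨!![⟨1, 0⟩, ⟨0, 1⟩; ⟨1, 1⟩, ⟨0, 0⟩], by rw [Matrix.det_fin_two_of]; decide⟩,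
      ⟨!![⟨1, 0⟩, ⟨1, 1⟩; ⟨0, 0⟩, ⟨1, 0⟩], by rw [Matrix.det_fin_two_of]; decide⟩,
      ⟨!![⟨1, 0⟩, ⟨1, 1⟩; ⟨1, 0⟩, ⟨0, 1⟩], by rw [Matrix.det_fin_two_of]; decide⟩,
      ⟨!![⟨1, 0⟩, ⟨1, 1⟩; ⟨0, 1⟩, ⟨0, 0⟩], by rw [Matrix.det_fin_two_of]; decide⟩,
      ⟨!![⟨1, 0⟩, ⟨1, 1⟩; ⟨1, 1⟩, ⟨1, 1⟩], by rw [Matrix.det_fin_two_of]; decide⟩,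
      ⟨!![⟨0, 1⟩, ⟨0, 0⟩; ⟨0, 0⟩, ⟨1, 1⟩], by rw [Matrix.det_fin_two_of]; decide⟩,
      ⟨!![⟨0, 1⟩, ⟨0, 0⟩; ⟨1, 0⟩, ⟨1, 1⟩], by rw [Matrix.det_fin_two_of]; decide⟩,
      ⟨!![⟨0, 1⟩, ⟨0, 0⟩; ⟨0, 1⟩, ⟨1, 1⟩], by rw [Matrix.det_fin_two_of]; decide⟩,
      ⟨!![⟨0, 1⟩, ⟨0, 0⟩; ⟨1, 1⟩, ⟨1, 1⟩], by rw [Matrix.det_fin_two_of]; decide⟩,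
      ⟨!![⟨0, 1⟩, ⟨1, 0⟩; ⟨0, 0⟩, ⟨1, 1⟩], by rw [Matrix.det_fin_two_of]; decide⟩,
      ⟨!![⟨0, 1⟩, ⟨1, 0⟩; ⟨1, 0⟩, ⟨0, 0⟩], by rw [Matrix.det_fin_two_of]; decide⟩,
      ⟨!![⟨0, 1⟩, ⟨1, 0⟩; ⟨0, 1⟩, ⟨0, 1⟩], by rw [Matrix.det_fin_two_of]; decide⟩,
      ⟨!![⟨0, 1⟩, ⟨1, 0⟩; ⟨1, 1⟩, ⟨1, 0⟩], by rw [Matrix.det_fin_two_of]; decide⟩,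
      ⟨!![⟨0, 1⟩, ⟨0, 1⟩; ⟨0, 0⟩, ⟨1, 1⟩], by rw [Matrix.det_fin_two_of]; decide⟩,
      ⟨!![⟨0, 1⟩, ⟨0, 1⟩; ⟨1, 0⟩, ⟨0, 1⟩], by rw [Matrix.det_fin_two_of]; decide⟩,
      ⟨!![⟨0, 1⟩, ⟨0, 1⟩; ⟨0, 1⟩, ⟨1, 0⟩], by rw [Matrix.det_fin_two_of]; decide⟩,
      ⟨!![⟨0, 1⟩, ⟨0, 1⟩; ⟨1, 1⟩, ⟨0, 0⟩], by rw [Matrix.det_fin_two_of]; decide⟩,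
      ⟨!![⟨0, 1⟩, ⟨1, 1⟩; ⟨0, 0⟩, ⟨1, 1⟩], by rw [Matrix.det_fin_two_of]; decide⟩,
      ⟨!![⟨0, 1⟩, ⟨1, 1⟩; ⟨1, 0⟩, ⟨1, 0⟩], by rw [Matrix.det_fin_two_of]; decide⟩,
      ⟨!![⟨0, 1⟩, ⟨1, 1⟩; ⟨0, 1⟩, ⟨0, 0⟩], by rw [Matrix.det_fin_two_of]; decide⟩,
      ⟨!![⟨0, 1⟩, ⟨1, 1⟩; ⟨1, 1⟩, ⟨0, 1⟩], by rw [Matrix.det_fin_two_of]; decide⟩,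
      ⟨!![⟨1, 1⟩, ⟨0, 0⟩; ⟨0, 0⟩, ⟨0, 1⟩], by rw [Matrix.det_fin_two_of]; decide⟩,
      ⟨!![⟨1, 1⟩, ⟨0, 0⟩; ⟨1, 0⟩, ⟨0, 1⟩], by rw [Matrix.det_fin_two_of]; decide⟩,
      ⟨!![⟨1, 1⟩, ⟨0, 0⟩; ⟨0, 1⟩, ⟨0, 1⟩], by rw [Matrix.det_fin_two_of]; decide⟩,
      ⟨!![⟨1, 1⟩, ⟨0, 0⟩; ⟨1, 1⟩, ⟨0, 1⟩], by rw [Matrix.det_fin_two_of]; decide⟩,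
      ⟨!![⟨1, 1⟩, ⟨1, 0⟩; ⟨0, 0⟩, ⟨0, 1⟩], by rw [Matrix.det_fin_two_of]; decide⟩,
      ⟨!![⟨1, 1⟩, ⟨1, 0⟩; ⟨1, 0⟩, ⟨0, 0⟩], by rw [Matrix.det_fin_two_of]; decide⟩,
      ⟨!![⟨1, 1⟩, ⟨1, 0⟩; ⟨0, 1⟩, ⟨1, 0⟩], by rw [Matrix.det_fin_two_of]; decide⟩,
      ⟨!![⟨1, 1⟩, ⟨1, 0⟩; ⟨1, 1⟩, ⟨1, 1⟩], by rw [Matrix.det_fin_two_of]; decide⟩,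
      ⟨!![⟨1, 1⟩, ⟨0, 1⟩; ⟨0, 0⟩, ⟨0, 1⟩], by rw [Matrix.det_fin_two_of]; decide⟩,
      ⟨!![⟨1, 1⟩, ⟨0, 1⟩; ⟨1, 0⟩, ⟨1, 0⟩], by rw [Matrix.det_fin_two_of]; decide⟩,
      ⟨!![⟨1, 1⟩, ⟨0, 1⟩; ⟨0, 1⟩, ⟨1, 1⟩], by rw [Matrix.det_fin_two_of]; decide⟩,
      ⟨!![⟨1, 1⟩, ⟨0, 1⟩; ⟨1, 1⟩, ⟨0, 0⟩], by rw [Matrix.det_fin_two_of]; decide⟩,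
      ⟨!![⟨1, 1⟩, ⟨1, 1⟩; ⟨0, 0⟩, ⟨0, 1⟩], by rw [Matrix.det_fin_two_of]; decide⟩,
      ⟨!![⟨1, 1⟩, ⟨1, 1⟩; ⟨1, 0⟩, ⟨1, 1⟩], by rw [Matrix.det_fin_two_of]; decide⟩,
      ⟨!![⟨1, 1⟩, ⟨1, 1⟩; ⟨0, 1⟩, ⟨0, 0⟩], by rw [Matrix.det_fin_two_of]; decide⟩,
      ⟨!![⟨1, 1⟩, ⟨1, 1⟩; ⟨1, 1⟩, ⟨1, 0⟩], by rw [Matrix.det_fin_two_of]; decide⟩] :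
        Fin 60 → Matrix.SpecialLinearGroup (Fin 2) (QuadraticAlgebra (ZMod 2) 1 1))
    -- `S` : the 17 line representatives `(1, t)`, `(0, 1)` of `K²`
    ({![⟨⟨1, 0⟩, ⟨0, 0⟩⟩, ⟨⟨0, 0⟩, ⟨0, 0⟩⟩], ![⟨⟨1, 0⟩, ⟨0, 0⟩⟩, ⟨⟨1, 0⟩, ⟨0, 0⟩⟩], ![⟨⟨1, 0⟩, ⟨0, 0⟩⟩, ⟨⟨0, 1⟩, ⟨0, 0⟩⟩], ![⟨⟨1, 0⟩, ⟨0, 0⟩⟩, ⟨⟨1, 1⟩, ⟨0, 0⟩⟩], ![⟨⟨1, 0⟩, ⟨0, 0⟩⟩, ⟨⟨0, 0⟩, ⟨1, 0⟩⟩], ![⟨⟨1, 0⟩, ⟨0, 0⟩⟩, ⟨⟨1, 0⟩, ⟨1, 0⟩⟩], ![⟨⟨1, 0⟩, ⟨0, 0⟩⟩, ⟨⟨0, 1⟩, ⟨1, 0⟩⟩], ![⟨⟨1, 0⟩, ⟨0, 0⟩⟩, ⟨⟨1, 1⟩, ⟨1, 0⟩⟩], ![⟨⟨1, 0⟩, ⟨0,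 0⟩⟩, ⟨⟨0, 0⟩, ⟨0, 1⟩⟩], ![⟨⟨1, 0⟩, ⟨0, 0⟩⟩, ⟨⟨1, 0⟩, ⟨0, 1⟩⟩], ![⟨⟨1, 0⟩, ⟨0, 0⟩⟩, ⟨⟨0, 1⟩, ⟨0, 1⟩⟩], ![⟨⟨1, 0⟩, ⟨0, 0⟩⟩, ⟨⟨1, 1⟩, ⟨0, 1⟩⟩], ![⟨⟨1, 0⟩, ⟨0, 0⟩⟩, ⟨⟨0, 0⟩, ⟨1, 1⟩⟩], ![⟨⟨1, 0⟩, ⟨0, 0⟩⟩, ⟨⟨1, 0⟩, ⟨1, 1⟩⟩], ![⟨⟨1, 0⟩, ⟨0, 0⟩⟩, ⟨⟨0, 1⟩, ⟨1, 1⟩⟩], ![⟨⟨1, 0⟩, ⟨0, 0⟩⟩, ⟨⟨1, 1⟩, ⟨1, 1⟩⟩], ![⟨⟨0, 0⟩, ⟨0, 0⟩⟩, ⟨⟨1, 0⟩, ⟨0, 0⟩⟩]} :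
        Finset (Fin 2 → QuadraticAlgebra (QuadraticAlgebra (ZMod 2) 1 1) ⟨0, 1⟩ 1))
    (by decide) (by decide) (by native_decide)
    (fun j => by fin_cases j <;> [exact subfieldCell_sixteen_sepA 0 (Or.inl rfl); exact subfieldCell_sixteen_sepA 1 (Or.inr rfl); exact subfieldCell_sixteen_sepB 2 (Or.inl rfl); exact subfieldCell_sixteen_sepB 3 (Or.inr rfl); exact subfieldCell_sixteen_sepC 4 rfl])

end Summit.MatrixMultiplication.MatrixMultiplication.Theorems.GradedDesignFamily
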